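import Literature.Barriers.CriticalPhenomena.RigorousRGSmallParameterSelfSimilarMass
import HarnessLib

/-!
# `RigorousRGSmallParameter` (Slade, Theorem 1.4.1): regularity and compact support of the
# scaling function `c₀(·, A)` in the spatial variable

Sixth file of the §10.3 layer; the spatial regularity of `c₀` used by the Riemann-sum and
support arguments of the proof of Lemma 5.2.2 (§10.4: "Riemann sum approximation gives …
`= L^{εk}O(L^{-k})‖∇(c₀c_l)‖_{L^∞}`", "we use the fact that the supports of `C_k` and `R_k` are
`O(L^{dk})`", "Since `c₀` has support of order 1, `|⟨c₀,c_k⟩| ≤ O(L^{-(d-α)k})`"). G. Slade,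
*Critical exponents for long-range `O(n)` models below the upper critical dimension*, Commun. Math.
Phys. **358** (2018), §10.3: "We define a smooth function `c₀ : ℝ^d × [0,∞) → ℝ`, with compact
support in `ℝ^d`, by (10.40)."

In the paper the compact support of `c₀(·,m²)` comes from that of `w̄(·;σ)` (finite propagation speed
of the continuum wave equation, [Baue13a, Example 1.3]). Here it is DERIVED instead from the finite
range of the lattice covariances (Proposition 3.3.1: `C_{j;0,x} = 0` for `|x|₁ ≥ ½L^j`, the tree's
`FRD.Gam_eq_zero`) through Lemma 10.3.1 (`FRD.Slade2017_lem1031`): at the lattice points `x/L^k`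
outside the range one gets `|c₀(x/L^k, A)| ≤ C L^{-k}` for every `A` (choosing `m² = A(L^k)^{-α}`),
these points are `L^{-k}`-dense, and `c₀(·,A)` is Lipschitz — so `c₀(y,A) = 0` whenever `|y|₁ > ½`.

## What this file proves (everything; no definition, no named fact)

* `FRD.abs_wbar_sub_le` — `|w̄(y;σ) - w̄(y';σ)| ≤ Lw(1+σ)^{-p}‖y-y'‖_∞` (`σ ≥ 0`).
* `FRD.abs_cZeroKer_sub_le` — the same for the inner kernel `G_L(·,σ)` with `(1+σ/(8dL²))^{-p}`.
* **`FRD.abs_cZero_sub_le`** — `c₀(·,A)` is Lipschitz in `‖·‖_∞`, uniformly in `A`;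
  **`FRD.abs_cZero_le`** — `|c₀(y,A)| ≤ C₀` uniformly.
* `FRD.floor_approx` — lattice approximation `x_i = ⌊Λy_i⌋`.
* **`FRD.cZero_eq_zero_of_half_lt`** — **compact support**: for `d ≥ 1`, `α ∈ (0,2)`, `L ≥ 2`,
  `Σ_i|y_i| > ½ ⟹ c₀(y,A) = 0` for every `A`.
-/

noncomputable section

namespace Literature.Barriers.CriticalPhenomena

open _root_.MeasureTheory Set Filter
open scoped _root_.Topology Real

namespace LongRangePhi4

namespace FRD

open Literature.Probability.LatticeModels

variable {d : ℕ}

/-! ### Regularity of the scaling function `c₀` in the spatial variable -/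

/-- **Lipschitz continuity of `w̄(·;σ)` with decay in `σ`**: for `d ≥ 1` and every `p` there is `Lw`
with `|w̄(y;σ) - w̄(y';σ)| ≤ Lw (1+σ)^{-p} ‖y - y'‖_∞` for all `σ ≥ 0` (`|cos(u·y) - cos(u·y')| ≤
|u·(y-y')| ≤ d‖u‖_∞‖y-y'‖_∞` and the rapid decay of `f` with one moment). [cite: Slade2017, §10.3 ((10.39)–(10.40): "a smooth function c₀")] -/
theorem abs_wbar_sub_le (hd : 1 ≤ d) (p : ℕ) :
    ∃ Lw : ℝ, 0 < Lw ∧ ∀ σ : ℝ, 0 ≤ σ → ∀ y y' : Fin d → ℝ,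
      |wbar d σ y - wbar d σ y'| ≤ Lw * ((1 + σ) ^ p)⁻¹ * ‖y - y'‖ := by
  have hd' : (1 : ℝ) ≤ d := by exact_mod_cast hd
  have hπ := Real.pi_pos
  set g : (Fin d → ℝ) → ℝ := fun u => ‖u‖ ^ 1 * ((1 + ‖u‖ ^ 2) ^ (d + 1))⁻¹ with hg
  have hgi : Integrable g := integrable_norm_pow_mul 1 (by omega)
  have hg0 : ∀ u, 0 ≤ g u := fun u => by positivity
  set I : ℝ := ∫ u, g u with hI
  have hI0 : 0 ≤ I := integral_nonneg hg0
  obtain ⟨C, hC, hf⟩ := abs_profile_sqrt_le profile (p + (d + 1))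
  refine ⟨((2 * π) ^ d : ℝ)⁻¹ * (C * d * I) + 1, by positivity, fun σ hσ y y' => ?_⟩
  have hsq : Continuous (sqNorm : (Fin d → ℝ) → ℝ) := by
    unfold sqNorm
    fun_prop
  -- integrability of both integrands
  have hint : ∀ z : Fin d → ℝ, Integrable fun u : Fin d → ℝ =>
      (profile (Real.sqrt (sqNorm u + σ))).re * Real.cos (∑ i, u i * z i) := by
    intro z
    obtain ⟨C', hC', hf'⟩ := abs_profile_sqrt_le profile d
    have hgi' : Integrable fun u : Fin d → ℝ => ((1 + ‖u‖ ^ 2) ^ d)⁻¹ :=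
      integrable_inv_one_add_norm_sq_pow (by omega)
    have hcont : Continuous fun u : Fin d → ℝ =>
        (profile (Real.sqrt (sqNorm u + σ))).re * Real.cos (∑ i, u i * z i) :=
      (Complex.continuous_re.comp (profile.continuous.comp (hsq.add continuous_const).sqrt)).mul
        (Real.continuous_cos.comp (by fun_prop))
    refine Integrable.mono' (hgi'.const_mul C') hcont.aestronglyMeasurable (Eventually.of_forall fun u => ?_)
    rw [Real.norm_eq_abs, abs_mul]
    refine (mul_le_of_le_one_right (abs_nonneg _) (Real.abs_cos_le_one _)).trans ?_
    have h1 := hf' 1 zero_le_one (sqNorm u + σ) (add_nonneg (sqNorm_nonneg u) hσ)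
    rw [one_mul, one_pow, one_mul] at h1
    refine h1.trans (mul_le_mul_of_nonneg_left ?_ hC'.le)
    apply inv_anti₀ (by positivity)
    exact pow_le_pow_left₀ (by positivity) (by linarith [norm_sq_le_sqNorm u, sqNorm_nonneg u]) d
  -- pointwise bound of the difference
  have hpt : ∀ u : Fin d → ℝ,
      |(profile (Real.sqrt (sqNorm u + σ))).re * Real.cos (∑ i, u i * y i) -
        (profile (Real.sqrt (sqNorm u + σ))).re * Real.cos (∑ i, u i * y' i)| ≤
        C * d * ((1 + σ) ^ p)⁻¹ * ‖y - y'‖ * g u := by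
    intro u
    rw [← mul_sub, abs_mul]
    have h1 := hf 1 zero_le_one (sqNorm u + σ) (add_nonneg (sqNorm_nonneg u) hσ)
    rw [one_mul, one_pow, one_mul] at h1
    -- `|cos a - cos b| ≤ |a - b| ≤ d ‖u‖ ‖y - y'‖`
    have h2 : |Real.cos (∑ i, u i * y i) - Real.cos (∑ i, u i * y' i)| ≤ d * ‖u‖ * ‖y - y'‖ := by
      refine (Real.abs_cos_sub_cos_le _ _).trans ?_
      rw [← Finset.sum_sub_distrib]
      calc |∑ i, (u i * y i - u i * y' i)| ≤ ∑ i, |u i * y i - u i * y' i| := Finset.abs_sum_le_sum_abs _ _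
        _ ≤ ∑ _i : Fin d, ‖u‖ * ‖y - y'‖ := Finset.sum_le_sum fun i _ => by
            rw [← mul_sub, abs_mul]
            refine mul_le_mul ?_ ?_ (abs_nonneg _) (norm_nonneg _)
            · simpa using norm_le_pi_norm u i
            · have := norm_le_pi_norm (y - y') i
              simpa [Pi.sub_apply, Real.norm_eq_abs] using this
        _ = d * ‖u‖ * ‖y - y'‖ := by simp; ring
    -- decay split: `(1+X)^{-(p+d+1)} ≤ (1+σ)^{-p}(1+‖u‖²)^{-(d+1)}`
    have h3 : ((1 + (sqNorm u + σ)) ^ (p + (d + 1)))⁻¹ ≤ ((1 + σ) ^ p)⁻¹ * ((1 + ‖u‖ ^ 2) ^ (d + 1))⁻¹ := by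
      rw [← mul_inv, pow_add]
      apply inv_anti₀ (by positivity)
      have hA : 1 + σ ≤ 1 + (sqNorm u + σ) := by linarith [sqNorm_nonneg u]
      have hB : 1 + ‖u‖ ^ 2 ≤ 1 + (sqNorm u + σ) := by linarith [norm_sq_le_sqNorm u]
      exact mul_le_mul (pow_le_pow_left₀ (by positivity) hA p) (pow_le_pow_left₀ (by positivity) hB _)
        (by positivity) (pow_nonneg (by linarith [sqNorm_nonneg u]) _)
    calc |(profile (Real.sqrt (sqNorm u + σ))).re| * |Real.cos (∑ i, u i * y i) - Real.cos (∑ i, u i * y' i)|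
        ≤ C * ((1 + (sqNorm u + σ)) ^ (p + (d + 1)))⁻¹ * (d * ‖u‖ * ‖y - y'‖) :=
          mul_le_mul h1 h2 (abs_nonneg _)
            (mul_nonneg hC.le (inv_nonneg.2 (pow_nonneg (by linarith [sqNorm_nonneg u]) _)))
      _ ≤ C * (((1 + σ) ^ p)⁻¹ * ((1 + ‖u‖ ^ 2) ^ (d + 1))⁻¹) * (d * ‖u‖ * ‖y - y'‖) := by gcongr
      _ = C * d * ((1 + σ) ^ p)⁻¹ * ‖y - y'‖ * g u := by rw [hg]; ring
  have hB : |∫ u : Fin d → ℝ, ((profile (Real.sqrt (sqNorm u + σ))).re * Real.cos (∑ i, u i * y i) -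
      (profile (Real.sqrt (sqNorm u + σ))).re * Real.cos (∑ i, u i * y' i))| ≤
      C * d * ((1 + σ) ^ p)⁻¹ * ‖y - y'‖ * I := by
    have h1 := norm_integral_le_of_norm_le (hgi.const_mul (C * d * ((1 + σ) ^ p)⁻¹ * ‖y - y'‖))
      (Eventually.of_forall fun u => by rw [Real.norm_eq_abs]; exact hpt u)
    rw [Real.norm_eq_abs, integral_const_mul] at h1
    exact h1
  have hπd : (0 : ℝ) < ((2 * π) ^ d : ℝ)⁻¹ := by positivity
  unfold wbar
  rw [← mul_sub, ← integral_sub (hint y) (hint y'), abs_mul, abs_of_pos hπd]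
  have hX : 0 ≤ ((1 + σ) ^ p)⁻¹ * ‖y - y'‖ := by positivity
  calc ((2 * π) ^ d : ℝ)⁻¹ * |∫ u : Fin d → ℝ, ((profile (Real.sqrt (sqNorm u + σ))).re * Real.cos (∑ i, u i * y i) -
        (profile (Real.sqrt (sqNorm u + σ))).re * Real.cos (∑ i, u i * y' i))|
      ≤ ((2 * π) ^ d : ℝ)⁻¹ * (C * d * ((1 + σ) ^ p)⁻¹ * ‖y - y'‖ * I) := mul_le_mul_of_nonneg_left hB hπd.le
    _ = ((2 * π) ^ d : ℝ)⁻¹ * (C * d * I) * (((1 + σ) ^ p)⁻¹ * ‖y - y'‖) := by ring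
    _ ≤ (((2 * π) ^ d : ℝ)⁻¹ * (C * d * I) + 1) * (((1 + σ) ^ p)⁻¹ * ‖y - y'‖) := by
        nlinarith
    _ = _ := by ring

/-- **Lipschitz continuity of the inner kernel `G_L(·,σ)` with decay in `σ`**:
`|G_L(y,σ) - G_L(y',σ)| ≤ Lk (1+σ/(8dL²))^{-p} ‖y-y'‖_∞` (`L ≥ 1`, `σ ≥ 0`).
[cite: Slade2017, §10.3 (display (10.40))] -/
theorem abs_cZeroKer_sub_le (hd : 1 ≤ d) {L : ℝ} (hL : 1 ≤ L) (p : ℕ) :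
    ∃ Lk : ℝ, 0 < Lk ∧ ∀ σ : ℝ, 0 ≤ σ → ∀ y y' : Fin d → ℝ,
      |cZeroKer d L y σ - cZeroKer d L y' σ| ≤ Lk * ((1 + σ / (8 * d * L ^ 2)) ^ p)⁻¹ * ‖y - y'‖ := by
  have hd' : (1 : ℝ) ≤ d := by exact_mod_cast hd
  have hc := cProfile_pos
  have hL0 : 0 < L := by linarith
  obtain ⟨Lw, hLw, hw⟩ := abs_wbar_sub_le hd p
  obtain ⟨K, -, hG⟩ := abs_cZeroKer_le hd hL p
  have hM0 : 0 < Real.sqrt (2 * d) := Real.sqrt_pos.2 (by positivity)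
  obtain ⟨P, hP⟩ : ∃ P : ℝ, P = (Real.sqrt (2 * d) * (2 * L)) ^ d * (1 / (cProfile * (2 * d))) * (2 * L) :=
    ⟨_, rfl⟩
  have hP0 : 0 < P := by rw [hP]; positivity
  refine ⟨P * Lw * (Real.sqrt (2 * d) * (2 * L)) * (1 / 2) + 1, by positivity, fun σ hσ y y' => ?_⟩
  have hab : 1 / (2 * L) ≤ (1 / 2 : ℝ) := by
    rw [div_le_div_iff₀ (by positivity) (by positivity)]; linarith
  -- pointwise
  have hpt : ∀ τ ∈ Ioc (1 / (2 * L)) (1 / 2 : ℝ),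
      |cZeroIntegrand d y σ τ - cZeroIntegrand d y' σ τ| ≤
        P * Lw * (Real.sqrt (2 * d) * (2 * L)) * ((1 + σ / (8 * d * L ^ 2)) ^ p)⁻¹ * ‖y - y'‖ := by
    intro τ hτ
    have hτ0 : 0 < τ := lt_trans (by positivity) hτ.1
    have hinvτ : τ⁻¹ ≤ 2 * L := by
      rw [inv_le_comm₀ hτ0 (by positivity)]
      have := hτ.1
      rw [one_div] at this
      exact this.le
    -- prefactor bound (as in `abs_cZeroKer_le`)
    have hq0 : 0 ≤ (Real.sqrt (2 * d) / τ) ^ d * (τ ^ 2 / (cProfile * (2 * d))) / τ := by positivity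
    have hq : (Real.sqrt (2 * d) / τ) ^ d * (τ ^ 2 / (cProfile * (2 * d))) / τ ≤ P := by
      have ha : (Real.sqrt (2 * d) / τ) ^ d ≤ (Real.sqrt (2 * d) * (2 * L)) ^ d := by
        apply pow_le_pow_left₀ (by positivity)
        rw [div_eq_mul_inv]
        exact mul_le_mul_of_nonneg_left hinvτ hM0.le
      have hb : τ ^ 2 / (cProfile * (2 * d)) ≤ 1 / (cProfile * (2 * d)) := by
        apply div_le_div_of_nonneg_right _ (by positivity)
        nlinarith [hτ.2]
      rw [div_eq_mul_inv, hP]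
      exact mul_le_mul (mul_le_mul ha hb (by positivity) (by positivity)) hinvτ (by positivity)
        (by positivity)
    -- the `w̄`-difference
    have hσ' : 0 ≤ σ * τ ^ 2 / (2 * d) := by positivity
    have h1 := hw _ hσ' (fun i => Real.sqrt (2 * d) * y i / τ) (fun i => Real.sqrt (2 * d) * y' i / τ)
    have hnorm : ‖(fun i => Real.sqrt (2 * d) * y i / τ) - (fun i => Real.sqrt (2 * d) * y' i / τ)‖ ≤
        Real.sqrt (2 * d) * (2 * L) * ‖y - y'‖ := by
      have e : (fun i => Real.sqrt (2 * d) * y i / τ) - (fun i => Real.sqrt (2 * d) * y' i / τ) =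
          (Real.sqrt (2 * d) / τ) • (y - y') := by
        funext i
        simp only [Pi.sub_apply, Pi.smul_apply, smul_eq_mul]
        ring
      rw [e, norm_smul, Real.norm_eq_abs, abs_of_pos (by positivity)]
      refine mul_le_mul_of_nonneg_right ?_ (norm_nonneg _)
      rw [div_eq_mul_inv]
      exact mul_le_mul_of_nonneg_left hinvτ hM0.le
    have h2 : ((1 + σ * τ ^ 2 / (2 * d)) ^ p)⁻¹ ≤ ((1 + σ / (8 * d * L ^ 2)) ^ p)⁻¹ := by
      apply inv_anti₀ (by positivity)
      apply pow_le_pow_left₀ (by positivity)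
      have hτsq : 1 / (4 * L ^ 2) ≤ τ ^ 2 := by
        have h := pow_le_pow_left₀ (by positivity : (0 : ℝ) ≤ 1 / (2 * L)) hτ.1.le 2
        calc 1 / (4 * L ^ 2) = (1 / (2 * L)) ^ 2 := by field_simp; ring
          _ ≤ τ ^ 2 := h
      have h3 : σ / (8 * d * L ^ 2) ≤ σ * τ ^ 2 / (2 * d) := by
        have e : σ / (8 * d * L ^ 2) = σ * (1 / (4 * L ^ 2)) / (2 * d) := by
          field_simp
          ring
        rw [e]
        exact div_le_div_of_nonneg_right (mul_le_mul_of_nonneg_left hτsq hσ) (by positivity)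
      linarith
    have e : cZeroIntegrand d y σ τ - cZeroIntegrand d y' σ τ =
        ((Real.sqrt (2 * d) / τ) ^ d * (τ ^ 2 / (cProfile * (2 * d))) / τ) *
          (wbar d (σ * τ ^ 2 / (2 * d)) (fun i => Real.sqrt (2 * d) * y i / τ) -
            wbar d (σ * τ ^ 2 / (2 * d)) (fun i => Real.sqrt (2 * d) * y' i / τ)) := by
      unfold cZeroIntegrand
      ring
    rw [e, abs_mul, abs_of_nonneg hq0]
    calc (Real.sqrt (2 * d) / τ) ^ d * (τ ^ 2 / (cProfile * (2 * d))) / τ *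
          |wbar d (σ * τ ^ 2 / (2 * d)) (fun i => Real.sqrt (2 * d) * y i / τ) -
            wbar d (σ * τ ^ 2 / (2 * d)) (fun i => Real.sqrt (2 * d) * y' i / τ)|
        ≤ P * (Lw * ((1 + σ * τ ^ 2 / (2 * d)) ^ p)⁻¹ *
            ‖(fun i => Real.sqrt (2 * d) * y i / τ) - (fun i => Real.sqrt (2 * d) * y' i / τ)‖) :=
          mul_le_mul hq h1 (abs_nonneg _) hP0.le
      _ ≤ P * (Lw * ((1 + σ / (8 * d * L ^ 2)) ^ p)⁻¹ * (Real.sqrt (2 * d) * (2 * L) * ‖y - y'‖)) := by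
          gcongr
      _ = _ := by ring
  have hfi := (hG σ hσ y).1
  have hfi' := (hG σ hσ y').1
  have hgi : IntegrableOn (fun _ : ℝ => P * Lw * (Real.sqrt (2 * d) * (2 * L)) *
      ((1 + σ / (8 * d * L ^ 2)) ^ p)⁻¹ * ‖y - y'‖) (Ioc (1 / (2 * L)) (1 / 2 : ℝ)) :=
    (continuous_const.integrableOn_Icc).mono_set Ioc_subset_Icc_self
  unfold cZeroKer
  rw [← integral_sub hfi hfi']
  have hb := abs_setIntegral_le_of_abs_le measurableSet_Ioc (hfi.sub hfi') hgi hpt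
  refine hb.trans ?_
  rw [setIntegral_const, smul_eq_mul, Real.volume_real_Ioc_of_le hab]
  have hlen : 1 / 2 - 1 / (2 * L) ≤ (1 / 2 : ℝ) := by
    have : 0 ≤ 1 / (2 * L) := by positivity
    linarith
  have hlen0 : 0 ≤ 1 / 2 - 1 / (2 * L) := by linarith
  have hX : 0 ≤ ((1 + σ / (8 * d * L ^ 2)) ^ p)⁻¹ * ‖y - y'‖ := by positivity
  calc (1 / 2 - 1 / (2 * L)) * (P * Lw * (Real.sqrt (2 * d) * (2 * L)) *
        ((1 + σ / (8 * d * L ^ 2)) ^ p)⁻¹ * ‖y - y'‖)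
      = (1 / 2 - 1 / (2 * L)) * (P * Lw * (Real.sqrt (2 * d) * (2 * L))) *
          (((1 + σ / (8 * d * L ^ 2)) ^ p)⁻¹ * ‖y - y'‖) := by ring
    _ ≤ 1 / 2 * (P * Lw * (Real.sqrt (2 * d) * (2 * L))) *
          (((1 + σ / (8 * d * L ^ 2)) ^ p)⁻¹ * ‖y - y'‖) := by gcongr
    _ ≤ (P * Lw * (Real.sqrt (2 * d) * (2 * L)) * (1 / 2) + 1) *
          (((1 + σ / (8 * d * L ^ 2)) ^ p)⁻¹ * ‖y - y'‖) := by nlinarith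
    _ = _ := by ring

/-- **`c₀(·,A)` is Lipschitz, uniformly in the mass**: for `d ≥ 1`, `α ∈ (0,2)`, `L ≥ 1` there is
`Lc` with `|c₀(y,A) - c₀(y',A)| ≤ Lc ‖y - y'‖_∞` for all `A` and all `y, y'` ("a smooth function
`c₀ : ℝ^d × [0,∞) → ℝ`"). [cite: Slade2017, §10.3 (the sentence introducing (10.40))] -/
theorem abs_cZero_sub_le (hd : 1 ≤ d) {α : ℝ} (hα0 : 0 < α) (hα2 : α < 2) {L : ℝ} (hL : 1 ≤ L) :
    ∃ Lc : ℝ, 0 < Lc ∧ ∀ A : ℝ, ∀ y y' : Fin d → ℝ,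
      |cZero d L α y A - cZero d L α y' A| ≤ Lc * ‖y - y'‖ := by
  have hd' : (1 : ℝ) ≤ d := by exact_mod_cast hd
  have hβ0 : 0 < α / 2 := by positivity
  have hβ1 : α / 2 < 1 := by linarith
  obtain ⟨Lk, hLk, hk⟩ := abs_cZeroKer_sub_le hd hL 2
  have hb : (0 : ℝ) < 1 / (8 * d * L ^ 2) := by positivity
  have hsin : 0 < Real.sin (π * (α / 2)) := Real.sin_pos_of_pos_of_lt_pi (by positivity)
    (by nlinarith [Real.pi_pos])
  set cK : ℝ := (π * Real.sin (π * (α / 2)))⁻¹ with hcK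
  have hcK0 : 0 < cK := by positivity
  obtain ⟨hmi, hmle⟩ := integral_majorant_rpow_le (K := Lk * cK) (by positivity) hb
    (by linarith : (-1 : ℝ) < -(α / 2)) (by linarith : -(α / 2) < (1 : ℝ))
  set J : ℝ := Lk * cK * (1 / (-(α / 2) + 1) + ((1 / (8 * d * L ^ 2)) ^ 2)⁻¹ / (1 - -(α / 2))) with hJ
  have hJ0 : 0 < J := by
    have : 0 < -(α / 2) + 1 := by linarith
    have : 0 < 1 - -(α / 2) := by linarith
    positivity
  refine ⟨J, hJ0, fun A y y' => ?_⟩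
  have hiy := integrableOn_cZeroKer_mul_katoDensity hd hL hβ0 hβ1 A y
  have hiy' := integrableOn_cZeroKer_mul_katoDensity hd hL hβ0 hβ1 A y'
  unfold cZero
  rw [← integral_sub hiy hiy']
  have hle : ∀ᵐ σ ∂((volume : Measure ℝ).restrict (Ioi 0)),
      ‖cZeroKer d L y σ * Kato.katoDensity (α / 2) A σ - cZeroKer d L y' σ * Kato.katoDensity (α / 2) A σ‖ ≤
        ‖y - y'‖ * (Lk * cK * ((1 + 1 / (8 * d * L ^ 2) * σ) ^ 2)⁻¹ * σ ^ (-(α / 2))) := by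
    refine (ae_restrict_iff' measurableSet_Ioi).2 (Eventually.of_forall fun σ hσ => ?_)
    have hσ0 : (0 : ℝ) < σ := hσ
    have hρ0 := (Kato.katoDensity_pos hβ0 hβ1 A hσ0).le
    rw [Real.norm_eq_abs, ← sub_mul, abs_mul, abs_of_nonneg hρ0]
    have h1 := hk σ hσ0.le y y'
    have e1 : σ / (8 * d * L ^ 2) = 1 / (8 * d * L ^ 2) * σ := by ring
    rw [e1] at h1
    have h2 := katoDensity_le_const_mul_rpow_neg hβ0 hβ1 A hσ0
    rw [← hcK] at h2
    calc |cZeroKer d L y σ - cZeroKer d L y' σ| * Kato.katoDensity (α / 2) A σ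
        ≤ Lk * ((1 + 1 / (8 * d * L ^ 2) * σ) ^ 2)⁻¹ * ‖y - y'‖ * (cK * σ ^ (-(α / 2))) :=
          mul_le_mul h1 h2 hρ0 (by positivity)
      _ = _ := by ring
  have h := norm_integral_le_of_norm_le (hmi.const_mul ‖y - y'‖) hle
  rw [Real.norm_eq_abs, integral_const_mul] at h
  refine h.trans ?_
  rw [mul_comm]
  exact mul_le_mul_of_nonneg_right hmle (norm_nonneg _)

/-- **`c₀` is bounded, uniformly in `y` and the mass**: `|c₀(y,A)| ≤ C₀`.
[cite: Slade2017, §10.3 (displays (10.39)–(10.40))] -/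
theorem abs_cZero_le (hd : 1 ≤ d) {α : ℝ} (hα0 : 0 < α) (hα2 : α < 2) {L : ℝ} (hL : 1 ≤ L) :
    ∃ C₀ : ℝ, 0 < C₀ ∧ ∀ A : ℝ, ∀ y : Fin d → ℝ, |cZero d L α y A| ≤ C₀ := by
  have hd' : (1 : ℝ) ≤ d := by exact_mod_cast hd
  have hβ0 : 0 < α / 2 := by positivity
  have hβ1 : α / 2 < 1 := by linarith
  obtain ⟨K, hK, hG⟩ := abs_cZeroKer_le hd hL 2
  have hb : (0 : ℝ) < 1 / (8 * d * L ^ 2) := by positivity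
  have hsin : 0 < Real.sin (π * (α / 2)) := Real.sin_pos_of_pos_of_lt_pi (by positivity)
    (by nlinarith [Real.pi_pos])
  set cK : ℝ := (π * Real.sin (π * (α / 2)))⁻¹ with hcK
  have hcK0 : 0 < cK := by positivity
  obtain ⟨hmi, hmle⟩ := integral_majorant_rpow_le (K := K * cK) (by positivity) hb
    (by linarith : (-1 : ℝ) < -(α / 2)) (by linarith : -(α / 2) < (1 : ℝ))
  refine ⟨K * cK * (1 / (-(α / 2) + 1) + ((1 / (8 * d * L ^ 2)) ^ 2)⁻¹ / (1 - -(α / 2))), by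
    have : 0 < -(α / 2) + 1 := by linarith
    have : 0 < 1 - -(α / 2) := by linarith
    positivity, fun A y => ?_⟩
  have hiy := integrableOn_cZeroKer_mul_katoDensity hd hL hβ0 hβ1 A y
  unfold cZero
  have hle : ∀ᵐ σ ∂((volume : Measure ℝ).restrict (Ioi 0)),
      ‖cZeroKer d L y σ * Kato.katoDensity (α / 2) A σ‖ ≤
        K * cK * ((1 + 1 / (8 * d * L ^ 2) * σ) ^ 2)⁻¹ * σ ^ (-(α / 2)) := by
    refine (ae_restrict_iff' measurableSet_Ioi).2 (Eventually.of_forall fun σ hσ => ?_)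
    have hσ0 : (0 : ℝ) < σ := hσ
    have hρ0 := (Kato.katoDensity_pos hβ0 hβ1 A hσ0).le
    rw [Real.norm_eq_abs, abs_mul, abs_of_nonneg hρ0]
    have h1 := (hG σ hσ0.le y).2
    have e1 : σ / (8 * d * L ^ 2) = 1 / (8 * d * L ^ 2) * σ := by ring
    rw [e1] at h1
    have h2 := katoDensity_le_const_mul_rpow_neg hβ0 hβ1 A hσ0
    rw [← hcK] at h2
    calc |cZeroKer d L y σ| * Kato.katoDensity (α / 2) A σ
        ≤ K * ((1 + 1 / (8 * d * L ^ 2) * σ) ^ 2)⁻¹ * (cK * σ ^ (-(α / 2))) :=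
          mul_le_mul h1 h2 hρ0 (by positivity)
      _ = _ := by ring
  have h := norm_integral_le_of_norm_le hmi hle
  rw [Real.norm_eq_abs] at h
  exact h.trans hmle

/-! ### Compact support of `c₀(·,A)` from the finite range of `C_j` -/

/-- Lattice approximation of a point of `ℝ^d` at scale `Λ`: with `x_i = ⌊Λy_i⌋`,
`‖x/Λ - y‖_∞ ≤ Λ⁻¹` and `Σ_i|x_i| ≥ ΛΣ_i|y_i| - d`. [folklore] -/
theorem floor_approx {Λ : ℝ} (hΛ : 0 < Λ) (y : Fin d → ℝ) :
    ‖(fun i => ((⌊Λ * y i⌋ : ℤ) : ℝ) / Λ) - y‖ ≤ Λ⁻¹ ∧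
      Λ * (∑ i, |y i|) - d ≤ ((∑ i, (⌊Λ * y i⌋).natAbs : ℕ) : ℝ) := by
  have hfl : ∀ i, |((⌊Λ * y i⌋ : ℤ) : ℝ) - Λ * y i| ≤ 1 := by
    intro i
    rw [abs_le]
    constructor <;> linarith [Int.floor_le (Λ * y i), Int.lt_floor_add_one (Λ * y i)]
  constructor
  · refine (pi_norm_le_iff_of_nonneg (by positivity)).2 fun i => ?_
    simp only [Pi.sub_apply, Real.norm_eq_abs]
    have e : ((⌊Λ * y i⌋ : ℤ) : ℝ) / Λ - y i = (((⌊Λ * y i⌋ : ℤ) : ℝ) - Λ * y i) / Λ := by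
      field_simp
    rw [e, abs_div, abs_of_pos hΛ, div_le_iff₀ hΛ, inv_mul_cancel₀ hΛ.ne']
    exact hfl i
  · have hterm : ∀ i, Λ * |y i| - 1 ≤ (((⌊Λ * y i⌋).natAbs : ℕ) : ℝ) := by
      intro i
      rw [← Int.cast_natCast, Int.natCast_natAbs, Int.cast_abs]
      have := abs_sub_abs_le_abs_sub (Λ * y i) ((⌊Λ * y i⌋ : ℤ) : ℝ)
      rw [abs_sub_comm] at this
      rw [abs_mul, abs_of_pos hΛ] at this
      linarith [hfl i]
    push_cast
    calc Λ * ∑ i, |y i| - (d : ℝ) = ∑ i : Fin d, (Λ * |y i| - 1) := by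
          rw [Finset.sum_sub_distrib, Finset.mul_sum]; simp
      _ ≤ ∑ i, (((⌊Λ * y i⌋).natAbs : ℕ) : ℝ) := Finset.sum_le_sum fun i _ => hterm i

/-- **`c₀(·,A)` is supported in `{|y|₁ ≤ ½}`**, for every mass argument `A`: for `d ≥ 1`,
`α ∈ (0,2)`, `L ≥ 2`, `Σ_i|y_i| > ½` implies `c₀(y,A) = 0` ("with compact support in `ℝ^d`").
Derived here from the finite range `C_{j;0,x} = 0` for `|x|₁ ≥ ½L^j` (Proposition 3.3.1) through
Lemma 10.3.1: at lattice points `x/L^k` outside the range, `|c₀(x/L^k, A)| ≤ CL^{-k}` (choose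
`m² = A(L^k)^{-α}`), and `c₀(·,A)` is Lipschitz. [cite: Slade2017, §10.3 ("a smooth function c₀ : ℝ^d × [0,∞) → ℝ, with compact support in ℝ^d") and Proposition 3.3.1 (finite range)] -/
theorem cZero_eq_zero_of_half_lt (hd : 1 ≤ d) {α : ℝ} (hα0 : 0 < α) (hα2 : α < 2) {L : ℝ}
    (hL : 2 ≤ L) {y : Fin d → ℝ} (hy : 1 / 2 < ∑ i, |y i|) (A : ℝ) : cZero d L α y A = 0 := by
  have hL1 : (1 : ℝ) ≤ L := by linarith
  have hL0 : (0 : ℝ) < L := by linarith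
  obtain ⟨C, hC, h31⟩ := Slade2017_lem1031 hd hα0 hα2 hL
  obtain ⟨Lc, hLc, hlip⟩ := abs_cZero_sub_le hd hα0 hα2 hL1
  -- `|c₀(y,A)| ≤ (Lc + C) L^{-k}` for all large `k`
  set ε : ℝ := ∑ i, |y i| - 1 / 2 with hε
  have hε0 : 0 < ε := by rw [hε]; linarith
  have hkey : ∀ k : ℕ, 2 ≤ k → (d : ℝ) ≤ L ^ k * ε → |cZero d L α y A| ≤ (Lc + C) * (L ^ k)⁻¹ := by
    intro k hk hkε
    set Λ : ℝ := L ^ k with hΛ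
    have hΛ0 : 0 < Λ := pow_pos hL0 k
    obtain ⟨happ, hsum⟩ := floor_approx hΛ0 y
    set x : Site d := fun i => ⌊Λ * y i⌋ with hx
    -- `C_k(x) = 0` by finite range
    have hrange : Λ / 2 ≤ ((∑ i, (x i).natAbs : ℕ) : ℝ) := by
      have : Λ / 2 ≤ Λ * (∑ i, |y i|) - d := by
        rw [hε] at hkε
        nlinarith
      exact this.trans hsum
    set m2 : ℝ := A * (Λ ^ α)⁻¹ with hm2
    have hΛα : 0 < Λ ^ α := Real.rpow_pos_of_pos hΛ0 α
    have hA : m2 * Λ ^ α = A := by rw [hm2]; field_simp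
    have hzero : fracCov d L α m2 k x = 0 := by
      unfold fracCov
      rw [setIntegral_congr_fun measurableSet_Ioi (g := fun _ => (0 : ℝ)) fun s hs => by
        simp only
        rw [Gam_eq_zero hd hL0.le (le_of_lt hs) k x hrange, zero_mul]]
      simp
    have h1 := h31 k hk m2 x
    rw [← hΛ, hzero, zero_sub, abs_neg, hA, abs_mul, abs_of_pos (Real.rpow_pos_of_pos hΛ0 _)] at h1
    -- `|c₀(x/Λ, A)| ≤ C Λ⁻¹`
    have h2 : |cZero d L α (fun i => ((x i : ℤ) : ℝ) / Λ) A| ≤ C * Λ⁻¹ := by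
      have hp : 0 < Λ ^ (α - d) := Real.rpow_pos_of_pos hΛ0 _
      refine le_of_mul_le_mul_left (h1.trans_eq ?_) hp
      ring
    -- Lipschitz step
    have h3 := hlip A (fun i => ((x i : ℤ) : ℝ) / Λ) y
    have h4 : |cZero d L α y A| ≤ |cZero d L α (fun i => ((x i : ℤ) : ℝ) / Λ) A| + Lc * Λ⁻¹ := by
      have := abs_sub_abs_le_abs_sub (cZero d L α y A) (cZero d L α (fun i => ((x i : ℤ) : ℝ) / Λ) A)
      rw [abs_sub_comm] at this
      have h5 : Lc * ‖(fun i => ((x i : ℤ) : ℝ) / Λ) - y‖ ≤ Lc * Λ⁻¹ := mul_le_mul_of_nonneg_left happ hLc.le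
      linarith
    calc |cZero d L α y A| ≤ C * Λ⁻¹ + Lc * Λ⁻¹ := by linarith
      _ = (Lc + C) * Λ⁻¹ := by ring
  -- let `k → ∞`
  by_contra hne
  have hpos : 0 < |cZero d L α y A| := abs_pos.2 hne
  have hLinv : L⁻¹ < 1 := inv_lt_one_of_one_lt₀ (by linarith)
  have hLinv0 : 0 < L⁻¹ := by positivity
  -- choose `k` with `(Lc + C) L^{-k} < |c₀|` and `d ≤ L^k ε` and `k ≥ 2`
  obtain ⟨k₁, hk₁⟩ := exists_pow_lt_of_lt_one (div_pos hpos (by positivity : (0 : ℝ) < Lc + C)) hLinv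
  obtain ⟨k₂, hk₂⟩ := exists_pow_lt_of_lt_one (div_pos hε0 (by positivity : (0 : ℝ) < d + 1)) hLinv
  set k : ℕ := max (max k₁ k₂) 2 with hk
  have hk2 : 2 ≤ k := le_max_right _ _
  have hkk₁ : k₁ ≤ k := le_trans (le_max_left _ _) (le_max_left _ _)
  have hkk₂ : k₂ ≤ k := le_trans (le_max_right _ _) (le_max_left _ _)
  have hmono : ∀ {a b : ℕ}, a ≤ b → L⁻¹ ^ b ≤ L⁻¹ ^ a := fun hab =>
    pow_le_pow_of_le_one hLinv0.le hLinv.le hab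
  have hLk : (L ^ k)⁻¹ = L⁻¹ ^ k := by rw [inv_pow]
  have hd' : (0 : ℝ) < d := by exact_mod_cast hd
  have hkε : (d : ℝ) ≤ L ^ k * ε := by
    have h1 : L⁻¹ ^ k < ε / (d + 1) := lt_of_le_of_lt (hmono hkk₂) hk₂
    have hLk0 : 0 < L ^ k := pow_pos hL0 k
    rw [← hLk, lt_div_iff₀ (by positivity)] at h1
    have : (L ^ k)⁻¹ * (d + 1) * L ^ k = d + 1 := by field_simp
    nlinarith [mul_lt_mul_of_pos_right h1 hLk0]
  have hb := hkey k hk2 hkε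
  have h1 : L⁻¹ ^ k < |cZero d L α y A| / (Lc + C) := lt_of_le_of_lt (hmono hkk₁) hk₁
  rw [lt_div_iff₀ (by positivity)] at h1
  rw [hLk] at hb
  linarith [mul_comm (L⁻¹ ^ k) (Lc + C)]

end FRD

end LongRangePhi4

end Literature.Barriers.CriticalPhenomena
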